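import Summits.QuantumFields.YangMills.Theorems.ColdStartUniversalityLindebergSwapStepDownCompat
import Summits.QuantumFields.YangMills.Theorems.TransportPerturbationSynchronousShadowMeasurableWdisc
import Summits.QuantumFields.YangMills.Theorems.TransportPerturbationShadowAveraging
import Summits.QuantumFields.YangMills.Theorems.ColdStartUniversalityLatticeLangevinFeller
import Summits.QuantumFields.BalabanUV.T4Continuum.Support.SubstrateBlockAvgContinuity
import Literature.MathematicalPhysics.QuantumFieldTheory.Balaban1983to89.B12RTGaugeInvariance254
import HarnessLib

/-!
# Crux `ColdStartContinuumCauchy` (stmt-QuantumFields-24810, route `ColdStartUniversality`), LINE 3 «lindeberg_swap»: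
# SMALL-FIELD CONTINUITY OF BAŁABAN'S GUARDED AVERAGING AT THE COLD CONFIGURATION

Helper file (seat `ym-line-csu-p1`, g9; `--supports stmt-QuantumFields-24810`).  The block averaging OF RECORD (0.4) is GUARDED
(`BlockAveraging.corr`: the printed small-loop average on `Small`, else `1`), hence discontinuous in the configuration — the wall
of the rung `stub_shortWindowSwap` as typed (memo `rung-shortWindowSwap-wall.md`, evidence on the crux).  AT THE COLD CONFIGURATION
`1`, however, all loop variables are `1`, so `1` is an INTERIOR point of the nested small-loop classes on which the iterated averaging is
continuous (`SubstrateBlockAvgContinuity.continuousOn_iter_blockAvg`).  This file records the consequences used by the cold-window rung: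

* `exists_open_one_subset_nestedSmall` — an open neighbourhood of `1` inside `NestedSmall expMeanLogSU δ' k` (induction over levels:
  `continuousOn_rawIter`, `continuous_loopHol`, `continuous_dist1_SU`, `rawIter_one`);
* `continuousAt_iter_blockAvg_one`, `continuousAt_avgField_one`, `continuousAt_stepDown_one` — the `k`-fold averaging of record,
  the skeleton's `avgField K j` and its one-step map `stepDown K` are continuous AT `1`;
* `wdisc_one_le_sum_fieldDistAt`, `tendsto_sum_fieldDistAt_one`, `eventually_wdisc_one_lt`, `eventually_wdisc_stepDown_one_lt` — the
  scale-weighted discrepancy to `1` is dominated by a function continuous at `1` and vanishing there (identity gauge transformation in the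
  infimum), also through `stepDown`;
* `exists_hsDist_lt_subset` — an open neighbourhood of a configuration contains a Hilbert–Schmidt ball (compactness), whence
  `exists_hsDist_wdisc_one_lt` / `exists_hsDist_wdisc_stepDown_one_lt`: `wdisc_K(u, 1) < η` (resp. `wdisc_K(stepDown u', 1) < η`) as soon
  as `Σ_e ‖ρ(u e) − 1‖_F² < ρ(η)`;
* measurability of `stepDown` and of `u ↦ wdisc_K(stepDown u, 1)` (`measurable_stepDown`, `measurable_wdisc_stepDown_one`).

THEOREMS ONLY (no definition), no sorry.  HONEST FRAMING: plumbing for the cold-window (t₀ = 0) form of the rung; LINE 3's content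
(`stub_oneWindowSwap`, `stub_scalePropagation`, XL) is untouched; no crux, rung or summit is proved; the Yang–Mills mass gap is NOT proved.
-/

set_option autoImplicit false

noncomputable section

namespace Summit.QuantumFields.YangMills.Cruxes.ColdStartContinuumCauchy.LindebergSwap

open scoped BigOperators Topology NNReal
open Filter Set Function MeasureTheory
open Literature.MathematicalPhysics.QuantumFieldTheory
open Literature.MathematicalPhysics.QuantumFieldTheory.Balaban1983to89
open Literature.MathematicalPhysics.QuantumLattice
open Literature.MathematicalPhysics.QuantumFieldTheory.Balaban1983to89.BlockAveraging (blockAvg loopHol Idx)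
open Summit.QuantumFields.BalabanUV.T4Continuum.SubstrateBlockAvgContinuity
  (rawIter NestedSmall nestedSmall_zero nestedSmall_succ_eq rawIter_one continuousOn_rawIter continuousOn_iter_blockAvg
    continuous_loopHol continuous_dist1_SU smallContinuous_expMeanLogSU ESU_const_one)
open Summit.QuantumFields.BalabanUV.T4Continuum.SubstrateBackgroundDriven (loopHol_one_cfg)

/-! ## §1 The cold configuration is an interior point of the nested small-loop classes -/

/-- **An open neighbourhood of `1` inside the nested small-loop class** of the printed `SU(2)` average: for `0 < δ' < δ_SU` and every
depth `k` there is an open `O ∋ 1` with `O ⊆ NestedSmall expMeanLogSU δ' k` — by induction over the levels, cutting by the STRICT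
smallness condition on the (continuous on the previous class) unguarded iterate. [cite: Balaban1987RG1, (0.4) p.253] -/
theorem exists_open_one_subset_nestedSmall (P : Params) {δ' : ℝ} (hδ'0 : 0 < δ') (hδ' : δ' < (avSU).δ) :
    ∀ k : ℕ, ∃ O : Set (GaugeField P 0 G2), IsOpen O ∧ (1 : GaugeField P 0 G2) ∈ O ∧ O ⊆ NestedSmall avSU δ' k
  | 0 => ⟨Set.univ, isOpen_univ, Set.mem_univ _, by rw [nestedSmall_zero]⟩
  | k + 1 => by
    obtain ⟨O, hO, h1, hsub⟩ := exists_open_one_subset_nestedSmall P hδ'0 hδ' k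
    -- the strict level-`k` smallness condition, an open set of level-`k` fields
    set T : Set (GaugeField P k G2) := {V | ∀ (c : PBond P (k + 1)) (x : Idx P), dist1 (loopHol V c x) < δ'} with hT
    have hTo : IsOpen T := by
      rw [hT, Set.setOf_forall]
      refine isOpen_iInter_of_finite fun c => ?_
      rw [Set.setOf_forall]
      exact isOpen_iInter_of_finite fun x => isOpen_lt (continuous_dist1_SU.comp (continuous_loopHol c x)) continuous_const
    have hco : ContinuousOn (rawIter avSU k) O :=
      (continuousOn_rawIter avSU continuous_dist1_SU smallContinuous_expMeanLogSU hδ' k).mono hsub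
    refine ⟨O ∩ rawIter avSU k ⁻¹' T, hco.isOpen_inter_preimage hO hTo, ⟨h1, ?_⟩, ?_⟩
    · show rawIter avSU k 1 ∈ T
      rw [rawIter_one avSU (fun _ => ESU_const_one) k]
      intro c x
      rw [loopHol_one_cfg, GaugeGroup.dist1_one]; exact hδ'0
    · intro U hU
      rw [nestedSmall_succ_eq]
      exact ⟨hsub hU.1, fun c x => (hU.2 c x).le⟩

/-- **The `k`-fold averaging of record is continuous AT the cold configuration.** [cite: Balaban1987RG1, (0.4) p.253] -/
theorem continuousAt_iter_blockAvg_one (P : Params) (k : ℕ) :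
    ContinuousAt (Averaging.iter (fun j => (blockAvg (P := P) (j := j) avSU : Averaging P j G2)) k) 1 := by
  have hδ : (avSU).δ / 2 < (avSU).δ := half_lt_self (avSU).δ_pos
  obtain ⟨O, hO, h1, hsub⟩ := exists_open_one_subset_nestedSmall P (half_pos (avSU).δ_pos) hδ k
  exact ((continuousOn_iter_blockAvg avSU continuous_dist1_SU smallContinuous_expMeanLogSU hδ k).mono hsub).continuousAt
    (hO.mem_nhds h1)

variable (F : T3ContinuumYM3Torus.T3Family)

/-- Reading a configuration as a level-0 field is continuous (coordinate projections). [folklore] -/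
theorem continuous_toField (K : ℕ) : Continuous (toField F K) :=
  continuous_pi fun _ => continuous_apply _

/-- The cold configuration reads as the trivial field. [folklore] -/
theorem toField_one (K : ℕ) :
    toField F K (fun _ => (1 : G2)) = (1 : GaugeField (F.P K) 0 G2) := rfl

/-- The block-averaged fields of the cold configuration are trivial (`iter_blockAvg_one`). [cite: Balaban1987RG1, (0.4) p.253] -/
theorem avgField_one (K j : ℕ) : avgField F K j (fun _ => (1 : G2)) = 1 := by
  unfold avgField
  rw [toField_one]
  exact Summit.QuantumFields.YangMills.Theorems.TransportPerturbation.iter_blockAvg_one F K j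

/-- **`avgField K j` is continuous at the cold configuration.** [cite: Balaban1987RG1, (0.4) p.253] -/
theorem continuousAt_avgField_one (K j : ℕ) : ContinuousAt (avgField F K j) (fun _ => (1 : G2)) := by
  unfold avgField
  have h := continuousAt_iter_blockAvg_one (F.P K) j
  rw [← toField_one F K] at h
  exact h.comp (continuous_toField F K).continuousAt

/-- **`stepDown K` is continuous at the cold configuration** (one guarded averaging step on the finer tower + relabelling).
[cite: Balaban1987RG1, (0.4) p.253] -/
theorem continuousAt_stepDown_one (K : ℕ) : ContinuousAt (stepDown F K) (fun _ => (1 : G2)) := by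
  -- `stepDown = relabel ∘ (blockAvg avSU).avg ∘ toField`, and `(blockAvg avSU).avg = Averaging.iter _ 1`
  have hrel : Continuous fun (V : GaugeField (F.P (K + 1)) 1 G2) (e : Edge 3 ((F.P K).sitesPerDir 0)) =>
      V ⟨siteDown F K e.1, e.2⟩ := continuous_pi fun e => continuous_apply _
  have hit := continuousAt_iter_blockAvg_one (F.P (K + 1)) 1
  rw [← toField_one F (K + 1)] at hit
  have hcomp := hit.comp (continuous_toField F (K + 1)).continuousAt
  exact hrel.continuousAt.comp hcomp

/-! ## §2 The discrepancy to the cold configuration near the cold configuration -/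

/-- `discG_j(u, v) ≤ fieldDistAt_j(Ū_j, V̄_j)` — the identity gauge transformation in the infimum. [folklore] -/
theorem discG_le_fieldDistAt (K j : ℕ) (u v : GaugeConfig 3 ((F.P K).sitesPerDir 0) G2) :
    discG F K j u v ≤ fieldDistAt F K j (avgField F K j u) (avgField F K j v) := by
  unfold discG
  refine (ciInf_le ⟨0, ?_⟩ (fun _ => 1)).trans_eq ?_
  · rintro _ ⟨h, rfl⟩
    exact Real.iSup_nonneg fun _ => norm_nonneg _
  · rw [B12RTGaugeInvariance254.gaugeAct_one']

/-- **`wdisc_K(u, 1) ≤ Σ_j L^{-(K-j)} fieldDistAt_j(Ū_j, 1̄_j)`.** [folklore] -/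
theorem wdisc_one_le_sum_fieldDistAt (K : ℕ) (u : GaugeConfig 3 ((F.P K).sitesPerDir 0) G2) :
    wdisc F K u (fun _ => 1) ≤ ∑ j ∈ Finset.range (K + 1), ((F.L : ℝ)⁻¹) ^ (K - j) *
      fieldDistAt F K j (avgField F K j u) (avgField F K j (fun _ => 1)) := by
  unfold wdisc
  exact Finset.sum_le_sum fun j _ => mul_le_mul_of_nonneg_left (discG_le_fieldDistAt F K j u _)
    (pow_nonneg (inv_nonneg.mpr (Nat.cast_nonneg _)) _)

/-- `fieldDistAt_j(V, V) = 0`. [folklore] -/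
theorem fieldDistAt_self (K j : ℕ) (V : GaugeField (F.P K) j G2) : fieldDistAt F K j V V = 0 := by
  unfold fieldDistAt
  simp only [sub_self, norm_zero, Real.iSup_const_zero]

/-- **The majorant tends to `0` at the cold configuration**: `Σ_j L^{-(K-j)} fieldDistAt_j(Ū_j, 1̄_j) → 0` as `u → 1`.
[cite: Balaban1987RG1, (0.4) p.253] -/
theorem tendsto_sum_fieldDistAt_one (K : ℕ) :
    Tendsto (fun u : GaugeConfig 3 ((F.P K).sitesPerDir 0) G2 => ∑ j ∈ Finset.range (K + 1), ((F.L : ℝ)⁻¹) ^ (K - j) *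
      fieldDistAt F K j (avgField F K j u) (avgField F K j (fun _ => 1))) (𝓝 (fun _ => 1)) (𝓝 0) := by
  have hterm : ∀ j : ℕ, Tendsto (fun u : GaugeConfig 3 ((F.P K).sitesPerDir 0) G2 =>
      fieldDistAt F K j (avgField F K j u) (avgField F K j (fun _ => 1))) (𝓝 (fun _ => 1)) (𝓝 0) := by
    intro j
    have hpair : Tendsto (fun u : GaugeConfig 3 ((F.P K).sitesPerDir 0) G2 =>
        (avgField F K j u, avgField F K j (fun _ => 1))) (𝓝 (fun _ => 1))
        (𝓝 (avgField F K j (fun _ => 1), avgField F K j (fun _ => 1))) :=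
      (continuousAt_avgField_one F K j).tendsto.prodMk_nhds tendsto_const_nhds
    -- the skeleton's `fieldDistAt` is the landed `SynchronousShadow.fieldDistAt` (same expression), jointly continuous
    have hfd : Continuous fun q : GaugeField (F.P K) j G2 × GaugeField (F.P K) j G2 => fieldDistAt F K j q.1 q.2 :=
      Summit.QuantumFields.YangMills.Cruxes.WeightedAlmostInvariance.SynchronousShadow.continuous_fieldDistAt F K j
    have h := (hfd.tendsto _).comp hpair
    rw [fieldDistAt_self] at h
    exact h
  have hsum := tendsto_finsetSum (Finset.range (K + 1))
    (fun j _ => (hterm j).const_mul (((F.L : ℝ)⁻¹) ^ (K - j)))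
  simpa using hsum

/-- **`wdisc_K(u, 1) → 0` as `u → 1`** (eventual form): for every `η > 0`, `wdisc_K(u, 1) < η` for all `u` near `1`. [folklore] -/
theorem eventually_wdisc_one_lt (K : ℕ) {η : ℝ} (hη : 0 < η) :
    ∀ᶠ u in 𝓝 (fun _ => (1 : G2)), wdisc F K u (fun _ => 1) < η := by
  filter_upwards [(tendsto_order.1 (tendsto_sum_fieldDistAt_one F K)).2 η hη] with u hu
  exact (wdisc_one_le_sum_fieldDistAt F K u).trans_lt hu

/-- **… and through one averaging step**: `wdisc_K(stepDown u', 1) < η` for all fine `u'` near `1`. [folklore] -/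
theorem eventually_wdisc_stepDown_one_lt (K : ℕ) {η : ℝ} (hη : 0 < η) :
    ∀ᶠ u' in 𝓝 (fun _ => (1 : G2)), wdisc F K (stepDown F K u') (fun _ => 1) < η := by
  have h := continuousAt_stepDown_one F K
  rw [ContinuousAt, StepDown.stepDown_one] at h
  exact h.eventually (eventually_wdisc_one_lt F K hη)

/-! ## §3 Hilbert–Schmidt balls and the quantitative forms -/

/-- **An open neighbourhood contains a Hilbert–Schmidt ball** (compactness of `SU(2)^E`; the «distance» separates points).
[folklore] -/
theorem exists_hsDist_lt_subset {N : ℕ} [NeZero N] {O : Set (GaugeConfig 3 N G2)} (hO : IsOpen O)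
    {x : GaugeConfig 3 N G2} (hx : x ∈ O) :
    ∃ ρ : ℝ, 0 < ρ ∧ ∀ u : GaugeConfig 3 N G2,
      ∑ e, hsForm 2 ((fundamentalRep (Fin 2) (u e) : Matrix (Fin 2) (Fin 2) ℂ) - fundamentalRep (Fin 2) (x e))
          ((fundamentalRep (Fin 2) (u e) : Matrix (Fin 2) (Fin 2) ℂ) - fundamentalRep (Fin 2) (x e)) < ρ → u ∈ O := by
  have hKc : IsCompact Oᶜ := hO.isClosed_compl.isCompact
  have hDc := Summit.QuantumFields.YangMills.Theorems.ColdStartUniversality.continuous_hsDist (L := N)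
    (X := GaugeConfig 3 N G2) continuous_id (continuous_const (y := x))
  by_cases hne : (Oᶜ).Nonempty
  · obtain ⟨p₀, hp₀, hmin⟩ := hKc.exists_isMinOn hne hDc.continuousOn
    refine ⟨∑ e, hsForm 2 ((fundamentalRep (Fin 2) (p₀ e) : Matrix (Fin 2) (Fin 2) ℂ) - fundamentalRep (Fin 2) (x e))
        ((fundamentalRep (Fin 2) (p₀ e) : Matrix (Fin 2) (Fin 2) ℂ) - fundamentalRep (Fin 2) (x e)), ?_, fun u hu => ?_⟩
    · rcases (Summit.QuantumFields.YangMills.Theorems.ColdStartUniversality.hsDist_nonneg p₀ x).lt_or_eq with hpos | hzero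
      · exact hpos
      · exfalso
        have heq := Summit.QuantumFields.YangMills.Theorems.ColdStartUniversality.eq_of_hsDist_eq_zero hzero.symm
        exact hp₀ (heq ▸ hx)
    · by_contra hcon
      exact absurd (hmin hcon) (not_le.2 hu)
  · refine ⟨1, one_pos, fun u _ => ?_⟩
    by_contra hcon
    exact hne ⟨u, hcon⟩

/-- **Quantitative form at the unit scale**: for every `η > 0` there is `ρ > 0` with `wdisc_K(u, 1) < η` whenever
`Σ_e ‖ρ(u e) − 1‖_F² < ρ`. [folklore] -/
theorem exists_hsDist_wdisc_one_lt (K : ℕ) {η : ℝ} (hη : 0 < η) :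
    ∃ ρ : ℝ, 0 < ρ ∧ ∀ u : GaugeConfig 3 ((F.P K).sitesPerDir 0) G2,
      ∑ e, hsForm 2 ((fundamentalRep (Fin 2) (u e) : Matrix (Fin 2) (Fin 2) ℂ) - fundamentalRep (Fin 2) (1 : G2))
          ((fundamentalRep (Fin 2) (u e) : Matrix (Fin 2) (Fin 2) ℂ) - fundamentalRep (Fin 2) (1 : G2)) < ρ →
        wdisc F K u (fun _ => 1) < η := by
  obtain ⟨O, hOsub, hO, h1⟩ := mem_nhds_iff.1 (eventually_wdisc_one_lt F K hη)
  obtain ⟨ρ, hρ, hball⟩ := exists_hsDist_lt_subset hO h1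
  exact ⟨ρ, hρ, fun u hu => hOsub (hball u hu)⟩

/-- **Quantitative form through one averaging step**: for every `η > 0` there is `ρ > 0` with `wdisc_K(stepDown u', 1) < η` whenever
the FINE configuration satisfies `Σ_e ‖ρ(u' e) − 1‖_F² < ρ`. [folklore] -/
theorem exists_hsDist_wdisc_stepDown_one_lt (K : ℕ) {η : ℝ} (hη : 0 < η) :
    ∃ ρ : ℝ, 0 < ρ ∧ ∀ u' : GaugeConfig 3 ((F.P (K + 1)).sitesPerDir 0) G2,
      ∑ e, hsForm 2 ((fundamentalRep (Fin 2) (u' e) : Matrix (Fin 2) (Fin 2) ℂ) - fundamentalRep (Fin 2) (1 : G2))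
          ((fundamentalRep (Fin 2) (u' e) : Matrix (Fin 2) (Fin 2) ℂ) - fundamentalRep (Fin 2) (1 : G2)) < ρ →
        wdisc F K (stepDown F K u') (fun _ => 1) < η := by
  obtain ⟨O, hOsub, hO, h1⟩ := mem_nhds_iff.1 (eventually_wdisc_stepDown_one_lt F K hη)
  obtain ⟨ρ, hρ, hball⟩ := exists_hsDist_lt_subset hO h1
  exact ⟨ρ, hρ, fun u hu => hOsub (hball u hu)⟩

/-! ## §4 Measurability through the averaging step -/

/-- `stepDown K` is measurable (the averaging of record is measurable, `T3Family.avgMeasurable_of_measurableE`). [folklore] -/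
theorem measurable_stepDown (K : ℕ) : Measurable (stepDown F K) := by
  have havg : Measurable (blockAvg (P := F.P (K + 1)) (j := 0) avSU).avg :=
    F.avgMeasurable_of_measurableE avSU T4ApexTwoLevel.measurableE_expMeanLogSU (K + 1) 0
  have hrel : Measurable fun (V : GaugeField (F.P (K + 1)) 1 G2) (e : Edge 3 ((F.P K).sitesPerDir 0)) =>
      V ⟨siteDown F K e.1, e.2⟩ := measurable_pi_lambda _ fun e => measurable_pi_apply _
  exact hrel.comp (havg.comp
    (Summit.QuantumFields.YangMills.Cruxes.WeightedAlmostInvariance.SynchronousShadow.measurable_toField F (K + 1)))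

/-- The skeleton's `wdisc` is jointly measurable (the landed `SynchronousShadow.measurable_wdisc`, same expression). [folklore] -/
theorem measurable_wdisc' (K : ℕ) :
    Measurable fun p : GaugeConfig 3 ((F.P K).sitesPerDir 0) G2 × GaugeConfig 3 ((F.P K).sitesPerDir 0) G2 =>
      wdisc F K p.1 p.2 :=
  Summit.QuantumFields.YangMills.Cruxes.WeightedAlmostInvariance.SynchronousShadow.measurable_wdisc F K

/-- `u ↦ wdisc_K(u, 1)` is measurable. [folklore] -/
theorem measurable_wdisc_one (K : ℕ) :
    Measurable fun u : GaugeConfig 3 ((F.P K).sitesPerDir 0) G2 => wdisc F K u (fun _ => 1) := by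
  have h := (measurable_wdisc' F K).comp (measurable_id.prodMk (measurable_const (a := fun _ => (1 : G2))))
  exact h

/-- `u' ↦ wdisc_K(stepDown u', 1)` is measurable. [folklore] -/
theorem measurable_wdisc_stepDown_one (K : ℕ) :
    Measurable fun u' : GaugeConfig 3 ((F.P (K + 1)).sitesPerDir 0) G2 => wdisc F K (stepDown F K u') (fun _ => 1) := by
  have h := (measurable_wdisc_one F K).comp (measurable_stepDown F K)
  exact h

/-- `0 ≤ wdisc_K ≤ 4` (the landed route item `TransportPerturbation.DiscrepancyBounds`, same expression). [cite: Balaban1985UV3, (4) p.256] -/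
theorem wdisc_nonneg_le_four (K : ℕ) (u v : GaugeConfig 3 ((F.P K).sitesPerDir 0) G2) :
    0 ≤ wdisc F K u v ∧ wdisc F K u v ≤ 4 :=
  Summit.QuantumFields.YangMills.Theorems.TransportPerturbation.discrepancyBounds_proof F K u v

end Summit.QuantumFields.YangMills.Cruxes.ColdStartContinuumCauchy.LindebergSwap

end
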